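import Mathlib.Data.Real.Basic
import Mathlib.Tactic.Linarith
import Mathlib.Tactic.Ring
import Mathlib.Tactic.FieldSimp
import Mathlib.Tactic.Positivity
import HarnessLib

/-!
# QUANT lane R8, T-DEC, leg (III), blob case — the thin regime of `MixLawCellPDear`: (e′) from the top-room condition, and arm-2's C1
# (in its LB1 form) from the core inequality (C1′) and (e′)

builds on p205010 (kernel theorem, internal audit signed; external expert review pending)

Support file (`--supports stmt-CriticalPhenomena-4575`), QUANT lane lead seat prim-quant-lead (gen 33), rung R8 of
`run/shared/lean/prim/quant/LADDER.md`.  Memo: arm-2 g36 `…/prim-quant-arm-2-g36/THIN-REGIME-G36.md` §2/§5; lead g33 HANDOFF GEN-33.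
Pure real arithmetic, standard axioms, no sorries.  Companions: `…ThinC1` (`thinC1'_of_bounds`), `…ThinBounds` (`thin_g_low`), `…ThinDelta`
(`thin_delta_low`, `thin_X_of_B2_TA`).

* `LawDec.thin_eprime` — the thin (no-top-room) condition `S(k₂−k₁) < (t−2k₁)k₂` with `t = S + α` gives (e′) `α(k₂−k₁) ≥ k₁(2k₂ − t)`
  (equivalently `α·k₂ + k₁S ≥ 2k₁k₂`; with `2k₂ − t = (k₂−k₁) + (k₁+k₂−t)`: `α ≥ k₁(1+δ)`).
* `LawDec.thin_C1_of_core` — C1 in cleared-denominator form, `k₁(1−g)(1−2λ)·d²(k₂−ℓ) ≤ Δ[k₁d² + a(k₂−a)Δ]·g(1−λ)` (`d = k₂−k₁`,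
  `Δ = k₁+k₂−t`, `k₂−ℓ = d−a`, `k₂−a = d+k₁−a`), from (C1′) `(1−g)(1−2λ) ≤ (1−λ)δ(g+δ+δ²)` (`δ = Δ/d`) and (e′) in the form `k₁(d+Δ) ≤ a·g·d`:
  LB1 ≥ k₁δ + aδ² (as `d ≥ k₂−ℓ`, `k₂−a ≥ k₂−ℓ`) and `a·g·δ² ≥ k₁δ²(1+δ)`.
With these, C1 on the thin regime is: `thin_X_of_B2_TA` → `thin_delta_low`, `thin_g_low`, `thin_eprime` → `thinC1'_of_bounds` → `thin_C1_of_core`.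
LEFT for the leaf (arm-2 next seat): `usage_twin_gap_lb` (B₁ ≥ LB1, light ℓ), (♥) ⟸ C1 + that, (I_{U₁}) ⟸ (♥) inside `kink_member_U1`'s thin branch.

[this work]; the chain: arm-2 g36.  Nothing here is cited as a published result.
-/

namespace Summit.CriticalPhenomena.PercolationContinuityZ3.Theorems

namespace Quant

namespace LawDec

/-- **(e′) from the no-top-room condition**: `S·(k₂ − k₁) < (t − 2k₁)·k₂` and `t = S + α` ⟹ `k₁(2k₂ − t) ≤ α(k₂ − k₁)`. [this work] -/
theorem thin_eprime (S t α k₁ k₂ : ℝ) (ht : t = S + α) (hthin : S * (k₂ - k₁) < (t - 2 * k₁) * k₂) :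
    k₁ * (2 * k₂ - t) ≤ α * (k₂ - k₁) := by
  rw [ht] at hthin ⊢
  nlinarith

set_option maxHeartbeats 400000 in
/-- **C1 from (C1′) and (e′)** (cleared denominators; `0 ≤ k₁`, `0 ≤ a < d`, `0 ≤ Δ`, `0 ≤ g`, `λ ≤ 1`). [this work] -/
theorem thin_C1_of_core (g lam k₁ a d q : ℝ) (hk₁ : 0 ≤ k₁) (ha : 0 ≤ a) (hd : 0 < d) (had : a < d) (hq : 0 ≤ q)
    (hg0 : 0 ≤ g) (hlam1 : lam ≤ 1)
    (he : k₁ * (d + q) ≤ a * g * d)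
    (hC1' : (1 - g) * (1 - 2 * lam) ≤ (1 - lam) * (q / d) * (g + q / d + (q / d) ^ 2)) :
    k₁ * (1 - g) * (1 - 2 * lam) * (d ^ 2 * (d - a)) ≤ q * (k₁ * d ^ 2 + a * (d + k₁ - a) * q) * (g * (1 - lam)) := by
  have hd2 : 0 < d ^ 2 := by positivity
  have hd3 : 0 < d ^ 3 := by positivity
  have hkl : 0 < d - a := by linarith
  have h1lam : 0 ≤ 1 - lam := by linarith
  -- (C1′) with denominators cleared: (1−g)(1−2λ)d³ ≤ (1−λ) q (g d² + q d + q²)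
  have hC : (1 - g) * (1 - 2 * lam) * d ^ 3 ≤ (1 - lam) * q * (g * d ^ 2 + q * d + q ^ 2) := by
    have e : (1 - lam) * (q / d) * (g + q / d + (q / d) ^ 2) * d ^ 3 = (1 - lam) * q * (g * d ^ 2 + q * d + q ^ 2) := by
      field_simp
    have := mul_le_mul_of_nonneg_right hC1' hd3.le
    rw [e] at this; exact this
  -- step 1: the LB1 numerator dominates (k₂−ℓ)(k₁ q d + a q²)·… :  q(k₁d² + a(d+k₁−a)q) ≥ (d − a)(k₁ q d + a q²)
  have hs1 : (d - a) * (k₁ * q * d + a * q ^ 2) ≤ q * (k₁ * d ^ 2 + a * (d + k₁ - a) * q) := by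
    nlinarith [mul_nonneg hk₁ hq, mul_nonneg ha (sq_nonneg q), mul_nonneg (mul_nonneg hk₁ hq) ha, mul_nonneg (mul_nonneg ha (sq_nonneg q)) hk₁,
      mul_nonneg (mul_nonneg hk₁ hq) hd.le]
  -- step 2: (e′) ⟹ a g q² d ≥ k₁ q² (d + q)
  have hs2 : k₁ * q ^ 2 * (d + q) ≤ a * g * q ^ 2 * d := by nlinarith [mul_le_mul_of_nonneg_left he (sq_nonneg q)]
  -- step 3: combine: RHS ≥ g(1−λ)(d−a)(k₁ q d + a q²) ≥ (1−λ)(d−a)(k₁ q d g + k₁ q²(d+q)/d) = k₁(1−λ)(d−a) q (g d² + q d + q²)/d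
  have hs3 : k₁ * (1 - lam) * (d - a) * (q * (g * d ^ 2 + q * d + q ^ 2))
      ≤ (1 - lam) * (d - a) * (k₁ * q * d * g + a * g * q ^ 2) * d := by
    -- k₁ q (g d² + q d + q²) = k₁ q d g · d + k₁ q² (d + q) ≤ k₁ q d g · d + a g q² d
    have e : k₁ * (q * (g * d ^ 2 + q * d + q ^ 2)) = (k₁ * q * d * g) * d + k₁ * q ^ 2 * (d + q) := by ring
    have h1 : k₁ * (q * (g * d ^ 2 + q * d + q ^ 2)) ≤ (k₁ * q * d * g + a * g * q ^ 2) * d := by rw [e]; nlinarith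
    have := mul_le_mul_of_nonneg_left h1 (mul_nonneg h1lam hkl.le)
    nlinarith
  have hs4 : (1 - lam) * (d - a) * (k₁ * q * d * g + a * g * q ^ 2) * d
      ≤ q * (k₁ * d ^ 2 + a * (d + k₁ - a) * q) * (g * (1 - lam)) * d := by
    have e : (1 - lam) * (d - a) * (k₁ * q * d * g + a * g * q ^ 2) * d = (g * (1 - lam)) * ((d - a) * (k₁ * q * d + a * q ^ 2)) * d := by
      ring
    rw [e]
    have := mul_le_mul_of_nonneg_left hs1 (mul_nonneg hg0 h1lam)
    nlinarith [mul_le_mul_of_nonneg_right this hd.le]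
  -- the left side: k₁(1−g)(1−2λ) d²(d−a) · d ≤ k₁ (1−λ) q (g d² + q d + q²) (d−a)   [from hC × k₁(d−a)]
  have hs5 : k₁ * (1 - g) * (1 - 2 * lam) * (d ^ 2 * (d - a)) * d ≤ k₁ * (1 - lam) * (d - a) * (q * (g * d ^ 2 + q * d + q ^ 2)) := by
    have := mul_le_mul_of_nonneg_left hC (mul_nonneg hk₁ hkl.le)
    nlinarith
  -- divide by d > 0
  have hfin : k₁ * (1 - g) * (1 - 2 * lam) * (d ^ 2 * (d - a)) * d ≤ q * (k₁ * d ^ 2 + a * (d + k₁ - a) * q) * (g * (1 - lam)) * d := by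
    linarith
  exact le_of_mul_le_mul_right hfin hd

end LawDec

end Quant

end Summit.CriticalPhenomena.PercolationContinuityZ3.Theorems
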